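import Summits.KontsevichZagierPeriods.KontsevichZagierPeriods.Theses.GenusOneIterated

/-!
# `EllGeneration` is downstream of the deciding hypotheses (route `GenusOneIterated`)

Structural facts about the typed layer-generation crux `EllGeneration`
(stmt-KontsevichZagierPeriods-7185; its informal twin `EllGenerationR`, stmt-14125, has no Lean
statement) of route `GenusOneIterated`, all pure algebra over the interfaces of
`Literature/NumberTheory/Transcendental/KZNoriSymbol.lean`:

* `eval_eq_zero_of_noriSymbol_eq_zero` — in EVERY model of Nori symbol data `Ψ`, a formal
  combination with vanishing Nori symbol has value `0` (field (Ψ1), `ev ∘ Ψ = eval`); so the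
  hypothesis `KZ.noriSymbol Ψ c = 0` of `EllGeneration` is never weaker than `KZ.eval c = 0`.
* `mem_relations_of_eval_eq_zero_of_sector_cruxes` — the five hypotheses of the route's deciding
  theorem `closes` (`DepthThreeFamily`, `DepthThreeLemniscatic`, `KummerLogTwo`,
  `SecondLyndonLemniscatic`, `OffGenusOneSectorKernel`) already give the INTEGRAL kernel form of
  Conjecture 1 for all formal combinations: `KZ.eval c = 0 → c ∈ KZ.relations` (the argument
  inlined in `closes`: each adjoined relator family lies in `KZ.relations` by its sector crux,
  `AddSubgroup.closure_le` + `sup_le`).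
* `ellGeneration_of_sector_cruxes` — hence the five hypotheses of `closes` imply `EllGeneration`:
  the typed crux is not independent of the deciding hypotheses (it is implied by them, for every
  classical period datum, kernel data and Nori symbol data, and for every `c`, inside or outside
  the genus-one subring).
* `ellGeneration_of_torsionFree_of_rationalKernel` — likewise from the shared frame
  `TorsionFree ∧ RationalKernel` of route `CoactionDevissage`.
* `mem_relations_of_ellGeneration_of_formalPeriodEvalInjective` — the intended use, downwards:
  `EllGeneration` together with ONE classical period datum (with kernel data and Nori symbol
  data) on which `ev` is injective (`FormalPeriodEvalInjective`, Kontsevich's formal period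
  conjecture for that datum) gives Conjecture 1 in kernel form on the genus-one subring:
  `KZ.eval c = 0 → c ∈ KZ.relations` for `c` in the subring.
* (remark, not a declaration) `EllGeneration` is verbatim the restriction of faithfulness of the
  Nori symbol data (`KZ.NoriSymbolData.IsFaithful`, thesis (b) of route `VeryGoodTransfer`) to
  the genus-one iterated-integral subring.

Nothing here proves or refutes `EllGeneration` itself (conjecture-grade: "motivic ⇒
KZ-accessible" on the sector, Huber–Müller-Stach 2017, Rem. 13.1.8); a refutation would need a
formal combination `c` with `KZ.eval c = 0` and `c ∉ KZ.relations`, i.e. a counterexample to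
Conjecture 1. Sources: M. Kontsevich, D. Zagier, *Periods* (2001), §1.2, §4.1; A. Huber,
S. Müller-Stach, *Periods and Nori Motives* (2017), §13.1.
-/

namespace Summit.KontsevichZagierPeriods.GenusOneIterated

open Literature.NumberTheory.Transcendental
open Summit.KontsevichZagierPeriods.KontsevichZagierPeriods.Theses.GenusOneIterated

/-- **(Ψ1) at zero.** For any Nori symbol data `Ψ` (any model of the interface
`KZ.NoriSymbolData R B σ`), a formal combination of integral representations whose Nori symbol
vanishes in the effective formal periods has value `0`: `Ψ c = 0 ⇒ eval c = ev (Ψ c) = 0`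
(Kontsevich–Zagier 2001, §4.1; `KZ.effectiveFormalPeriodEval_noriSymbol`). [folklore] -/
theorem eval_eq_zero_of_noriSymbol_eq_zero {k : Type} [Field k] [CharZero k]
    {P : Literature.AlgebraicGeometry.Motives.PeriodRealization k}
    {R : Literature.AlgebraicGeometry.Motives.RelativePeriodData P} {B : R.BoundaryData}
    {σ : k →+* ℂ} (Ψ : KZ.NoriSymbolData R B σ) {c : KZ.FormalRep} (hc : KZ.noriSymbol Ψ c = 0) :
    KZ.eval c = 0 := by
  have h := KZ.effectiveFormalPeriodEval_noriSymbol Ψ c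
  rw [hc, map_zero, map_zero] at h
  exact_mod_cast h.symm

/-- **The integral kernel form from the five hypotheses of `closes`.** If the four typed
genus-one relator families are KZ-moves (`DepthThreeFamily`, `DepthThreeLemniscatic`,
`KummerLogTwo`, `SecondLyndonLemniscatic`) and the remainder crux `OffGenusOneSectorKernel`
holds, then every formal combination with value `0` is a relation of the calculus:
`KZ.eval c = 0 → c ∈ KZ.relations`. This is the content derived inline in the route's deciding
theorem `closes` (each adjoined family lies in `KZ.relations` by its crux, so
`KZ.relations ⊔ closure S ≤ KZ.relations` by `AddSubgroup.closure_le` and `sup_le`).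
[folklore] -/
theorem mem_relations_of_eval_eq_zero_of_sector_cruxes (hF : DepthThreeFamily)
    (hL : DepthThreeLemniscatic) (hK : KummerLogTwo) (hS : SecondLyndonLemniscatic)
    (hO : OffGenusOneSectorKernel) (c : KZ.FormalRep) (hc : KZ.eval c = 0) :
    c ∈ KZ.relations := by
  have hc' := hO c hc
  refine (sup_le le_rfl ((AddSubgroup.closure_le _).2 ?_)) hc'
  rintro d (((hd | hd) | hd) | hd)
  · obtain ⟨e₁, e₂, e₃, r₃, rA, rB, rA', rL, h1, h2, h3, h4, h5, h6, h7, h8, h9, h10, h11, h12, h13,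
      h14, h15, h16, rfl⟩ := hd
    exact hF e₁ e₂ e₃ h1 h2 h3 h4 h5 h6 r₃ rA rB rA' rL h7 h8 h9 h10 h11 h12 h13 h14 h15 h16
  · obtain ⟨r₃, r₂, h1, h2, h3, h4, rfl⟩ := hd
    exact hL r₃ r₂ h1 h2 h3 h4
  · obtain ⟨r₂, r₁, h1, h2, h3, h4, rfl⟩ := hd
    exact hK r₂ r₁ h1 h2 h3 h4
  · obtain ⟨r₄, r₂, h1, h2, h3, h4, rfl⟩ := hd
    exact hS r₄ r₂ h1 h2 h3 h4

/-- **`EllGeneration` is implied by the deciding hypotheses.** The five hypotheses of `closes`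
imply the typed layer-generation crux `EllGeneration` (stmt-7185): given any classical period
datum with kernel data, any Nori symbol data `Ψ` and any `c` (membership in the genus-one
subring is not even used) with `Ψ c = 0`, one has `eval c = 0` by (Ψ1) and then
`c ∈ KZ.relations` by `mem_relations_of_eval_eq_zero_of_sector_cruxes`. [folklore] -/
theorem ellGeneration_of_sector_cruxes (hF : DepthThreeFamily) (hL : DepthThreeLemniscatic)
    (hK : KummerLogTwo) (hS : SecondLyndonLemniscatic) (hO : OffGenusOneSectorKernel) :
    EllGeneration := by
  intro 𝒞 _ Ψ c _ hΨ
  exact mem_relations_of_eval_eq_zero_of_sector_cruxes hF hL hK hS hO c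
    (eval_eq_zero_of_noriSymbol_eq_zero Ψ hΨ)

/-- **`EllGeneration` from the shared frame.** `TorsionFree` and `RationalKernel` (the frame of
route `CoactionDevissage`, listed in this route) imply `EllGeneration`: `Ψ c = 0 ⇒ eval c = 0 ⇒
n • c ∈ KZ.relations` for some `n ≠ 0` `⇒ c ∈ KZ.relations`. [folklore] -/
theorem ellGeneration_of_torsionFree_of_rationalKernel (hT : TorsionFree) (hR : RationalKernel) :
    EllGeneration := by
  intro 𝒞 _ Ψ c _ hΨ
  obtain ⟨n, hn, hnc⟩ := hR c (eval_eq_zero_of_noriSymbol_eq_zero Ψ hΨ)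
  exact hT n c hn hnc


/-- **The intended use of `EllGeneration`** ("motivic ⇒ KZ" + Kontsevich's formal period
conjecture ⇒ Conjecture 1 on the sector). If `EllGeneration` holds and some classical period
datum with kernel data carries Nori symbol data `Ψ` on which the evaluation map of effective
formal periods is injective (`FormalPeriodEvalInjective`, the formal period conjecture for that
datum), then every element of the genus-one iterated-integral subring with value `0` is a relation
of the calculus: `eval c = 0 ⇒ ev (Ψ c) = 0 ⇒ Ψ c = 0 ⇒ c ∈ KZ.relations` (Kontsevich–Zagier
2001, §4.1; Huber–Müller-Stach 2017, §13.1–13.2; cf. `KZ.kernel_subset_relations_of_isFaithful`).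
[folklore] -/
theorem mem_relations_of_ellGeneration_of_formalPeriodEvalInjective (hE : EllGeneration)
    (𝒞 : Literature.AlgebraicGeometry.Motives.ClassicalPeriodDatum ℚ) (h𝒞 : 𝒞.KernelData)
    (Ψ : 𝒞.NoriSymbolData (Rat.castHom ℂ))
    (hinj : FormalPeriodEvalInjective 𝒞.R 𝒞.B (Rat.castHom ℂ)) {c : KZ.FormalRep}
    (hcS : c ∈ NonUnitalSubring.closure
      ({d | ∃ (E : KZ.EllCurve) (γ : KZ.EllArc E) (n : ℕ) (w : Fin n → KZ.EllLetter)
          (hw : KZ.EllArc.Adapted γ w), d = KZ.of (KZ.ellIterRep γ w hw)} ∪ {KZ.of KZ.piRep} ∪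
        {d | ∃ (a : ℝ) (r : KZ.IntegralRep 1), IsAlgebraic ℚ a ∧ 1 < a ∧
          r.domain = {x | 1 < x 0 ∧ x 0 < a} ∧ Set.EqOn r.integrand (fun x => 1 / x 0) r.domain ∧
          d = KZ.of r}))
    (hc : KZ.eval c = 0) : c ∈ KZ.relations := by
  refine hE 𝒞 h𝒞 Ψ c hcS ?_
  have h1 : Literature.AlgebraicGeometry.Motives.AlongHom.equiv (Rat.castHom ℂ)
      (formalPeriodEval 𝒞.R (Rat.castHom ℂ) (Ψ.symbol c)) = 0 := by
    rw [Ψ.eval_symbol c, hc]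
    simp
  have h2 : formalPeriodEval 𝒞.R (Rat.castHom ℂ) (Ψ.symbol c) = 0 := by simpa using h1
  rw [KZ.noriSymbol_apply, Submodule.mkQ_apply, Submodule.Quotient.mk_eq_zero]
  exact hinj _ h2

end Summit.KontsevichZagierPeriods.GenusOneIterated
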